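import Mathlib
import Summits.NavierStokesRegularity.FluidComputer.BoundedGeneratorDuhamel
import Summits.NavierStokesRegularity.FluidComputer.LyapunovSkewCutSemigroup
import Summits.NavierStokesRegularity.FluidComputer.StabilityMildDuhamel

/-!
# Emergence and stability for a bounded generator: R-β and its KILL twin at the Galerkin level, modulo (B) only (instab g14, cell `ns-blowup`, 2026-08-26)

HONEST FRAMING (human ruling D-0035): nothing here is a claim about Navier–Stokes blow-up.
WHAT THIS IS NOT: not NS evidence. `EmergenceMildDuhamel` (g13) / `StabilityMildDuhamel` (g14)
prove the KEEP word (amplitude floor + clock) and the KILL word (basin radius + decay) of a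
certified linear core CONDITIONAL on three named analytic inputs (M) mild formula, (T) smoothing
bound, (B) bilinear loss. This file DISCHARGES (M) and (T) for a BOUNDED generator
`A : E →L[ℝ] E` on a complete inner-product space — the setting of every Galerkin truncation, where
the cell's certificates (X0 eigenpair, D2 / 3-L strong Lyapunov weight, 3-L′ / PART 4b two-level
pair) are actually computed:

* `norm_linearFlow_le_of_generator_form` — (T, strong level) from the 3-L certificate stated on
  the GENERATOR for all `w` (`Re⟪G w, A w⟫ ≤ ω₁ Re⟪G w, w⟫`, `m‖x‖² ≤ Re⟪Gx,x⟫ ≤ M‖x‖²`):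
  `‖e^{tA} x‖ ≤ √(M/m) e^{ω₁ t} ‖x‖` for all `t ≥ 0` and ALL `x`
  (`LyapunovSkewCutSemigroup.norm_le_of_generator_form` applied to the classical trajectory
  `s ↦ e^{sA} x`, `BoundedGeneratorDuhamel.hasDerivWithinAt_linearFlow`);
* `norm_linearFlow_le_of_two_level`, `smoothing_bound_linearFlow` — (T, smoothing) from the 3-L′
  two-level certificate stated on the generator for all `w`:
  `‖e^{τA} x‖ ≤ √(M₁/(c m₂)) · τ^{−1/2} · e^{ωτ} · √Re⟪D₁ x, x⟫` for all `τ > 0`, all `x`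
  (`norm_le_of_two_level` + `EmergenceMildDuhamel.smoothing_bound_of_two_level_shape`);
* `half_prediction_of_classical` — **R-β for a bounded generator, modulo (B) only**: given the
  two-level certificate, a normalised real eigenpair `A v = λ v` with the gap `2λ > ω`, and the
  bilinear loss (B) `√Re⟪D₁ B(x,y), B(x,y)⟫ ≤ c_alg ‖x‖ ‖y‖`, EVERY classical solution of
  `u' = A u + B(u,u)` on `[0, T₀]` with `u 0 = ε v` obeys the amplitude floor
  `‖u t‖ ≥ ε e^{λt}/2` wherever `ε e^{λt} ≤ χ⋆ = 2/(9C)` inside the window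
  (`C = S·c_alg·√(π/(2λ−ω))`, `S = √(M₁/(c m₂))`) — (M) by
  `BoundedGeneratorDuhamel.mild_formula_of_classical`, `‖ℓ t‖ = ε e^{λt}` by
  `norm_linearFlow_smul_eigenvector`;
* `decay_two_of_classical` — **the KILL twin for a bounded generator, modulo (B) only**: given the
  two-level certificate with `ω < 2λ ≤ 0`, a strong certificate with abscissa `ω₁ ≤ λ`, and (B),
  every classical solution whose seed satisfies `√(M/m)‖u 0‖ ≤ ε < ε₀ = 1/(4C)` obeys
  `‖u t‖ ≤ 2ε e^{λt}` on the whole window.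

So at the Galerkin level the R-β chain and its KILL twin are kernel theorems whose ONLY remaining
named input is (B) (the model-specific bilinear loss; for the torus convective term the displayed
constant is `ConvectiveProductLawLattice/Torus`, INSTAB-BRIDGE l.127 (a)). What separates this
from the TRUE linearised operator is unboundedness alone: generation of the semigroup by
`νℙΔ − ℙ[(U·∇)· + (·∇)U]` and the passage from Galerkin trajectories to the limit (density
clause: `EmergenceMildDuhamel.smoothing_bound_of_dense`). Nothing here is about singularity
formation. Mathlib + the four cited tree files; no new definitions.
-/

noncomputable section

namespace Summit.NavierStokesRegularity.FluidComputer.BoundedGeneratorEmergence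

open Set MeasureTheory intervalIntegral Filter Topology NormedSpace RCLike
open scoped InnerProductSpace
open Summit.NavierStokesRegularity.FluidComputer.LyapunovSkewCutSemigroup
open Summit.NavierStokesRegularity.FluidComputer.EmergenceMildDuhamel
open Summit.NavierStokesRegularity.FluidComputer.StabilityMildDuhamel
open Summit.NavierStokesRegularity.FluidComputer.BoundedGeneratorDuhamel
open Literature.Analysis.ODE

variable {𝕜 E : Type*} [RCLike 𝕜] [NormedAddCommGroup E] [InnerProductSpace 𝕜 E]
  [NormedSpace ℝ E] [CompleteSpace E]

/-! ### (T) for the linear flow of a bounded generator, from certificates stated on the generator -/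

/-- **Strong-level bound for the linear flow from a 3-L certificate on the generator.** If `G` is a
symmetric bounded weight with `m‖x‖² ≤ Re⟪Gx, x⟫ ≤ M‖x‖²` (`m > 0`) and the generator satisfies
(L) `Re⟪G w, A w⟫ ≤ ω₁ · Re⟪G w, w⟫` for EVERY `w`, then `‖e^{tA} x‖ ≤ √(M/m) · e^{ω₁ t} · ‖x‖`
for all `t ≥ 0` and all `x`. -/
theorem norm_linearFlow_le_of_generator_form (A : E →L[ℝ] E) {G : E →L[ℝ] E}
    (hG : ∀ x y : E, ⟪G x, y⟫_𝕜 = ⟪x, G y⟫_𝕜) {m M ω₁ : ℝ} (hm0 : 0 < m)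
    (hm : ∀ x : E, m * ‖x‖ ^ 2 ≤ re ⟪G x, x⟫_𝕜) (hM : ∀ x : E, re ⟪G x, x⟫_𝕜 ≤ M * ‖x‖ ^ 2)
    (hL : ∀ w : E, re ⟪G w, A w⟫_𝕜 ≤ ω₁ * re ⟪G w, w⟫_𝕜) :
    ∀ t : ℝ, 0 ≤ t → ∀ x : E,
      ‖exp (t • A) x‖ ≤ Real.sqrt (M / m) * Real.exp (ω₁ * t) * ‖x‖ := by
  intro t ht x
  have h := norm_le_of_generator_form (𝕜 := 𝕜) hG hm0 hm hM (D := Set.univ) (A := fun w => A w)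
    (fun w _ => hL w) (u := fun s : ℝ => exp (s • A) x) (T := t)
    (fun s _ => hasDerivWithinAt_linearFlow A x (Icc 0 t) s) (fun _ _ => Set.mem_univ _)
    t ⟨ht, le_rfl⟩
  simpa only [linearFlow_zero_apply] using h

/-- **Two-level (smoothing) bound for the linear flow from a 3-L′ certificate on the generator.** If
`G₁, G₂` are symmetric bounded weights, `Re⟪G₁x,x⟫ ≥ 0`, `m₂‖x‖² ≤ Re⟪G₂x,x⟫`, `Re⟪G₁x,x⟫ ≤
M₁ Re⟪D₁x,x⟫` with `Re⟪D₁x,x⟫ ≥ 0`, and the generator satisfies, for EVERY `w`, the coupled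
inequality `2Re⟪G₁w, Aw⟫ + c·Re⟪G₂w, w⟫ ≤ 2ω·Re⟪G₁w, w⟫` (`c > 0`) and `Re⟪G₂w, Aw⟫ ≤ ω·Re⟪G₂w, w⟫`,
then for all `τ > 0` and all `x`: `‖e^{τA} x‖ ≤ √(M₁/(c m₂)) · √(Re⟪D₁x,x⟫/τ) · e^{ωτ}`. -/
theorem norm_linearFlow_le_of_two_level (A : E →L[ℝ] E) {G₁ G₂ D₁ : E →L[ℝ] E}
    (hG₁ : ∀ x y : E, ⟪G₁ x, y⟫_𝕜 = ⟪x, G₁ y⟫_𝕜) (hG₂ : ∀ x y : E, ⟪G₂ x, y⟫_𝕜 = ⟪x, G₂ y⟫_𝕜)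
    (hG₁pos : ∀ x : E, 0 ≤ re ⟪G₁ x, x⟫_𝕜) {ω c m₂ M₁ : ℝ} (hc : 0 < c) (hm₂ : 0 < m₂)
    (hM₁ : 0 ≤ M₁) (hm₂' : ∀ x : E, m₂ * ‖x‖ ^ 2 ≤ re ⟪G₂ x, x⟫_𝕜)
    (hD₁ : ∀ x : E, 0 ≤ re ⟪D₁ x, x⟫_𝕜) (hM₁' : ∀ x : E, re ⟪G₁ x, x⟫_𝕜 ≤ M₁ * re ⟪D₁ x, x⟫_𝕜)
    (h₁ : ∀ w : E, 2 * re ⟪G₁ w, A w⟫_𝕜 + c * re ⟪G₂ w, w⟫_𝕜 ≤ 2 * ω * re ⟪G₁ w, w⟫_𝕜)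
    (h₂ : ∀ w : E, re ⟪G₂ w, A w⟫_𝕜 ≤ ω * re ⟪G₂ w, w⟫_𝕜) :
    ∀ τ : ℝ, 0 < τ → ∀ x : E, ‖exp (τ • A) x‖ ≤
      Real.sqrt (M₁ / (c * m₂)) * Real.sqrt (re ⟪D₁ x, x⟫_𝕜 / τ) * Real.exp (ω * τ) := by
  intro τ hτ x
  have h := norm_le_of_two_level (𝕜 := 𝕜) hG₁ hG₂ hG₁pos hc hm₂ hM₁ hm₂' hD₁ hM₁'
    (u := fun s : ℝ => exp (s • A) x) (u' := fun s : ℝ => A (exp (s • A) x)) (T := τ)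
    (fun s _ => hasDerivWithinAt_linearFlow A x (Icc 0 τ) s) (fun s _ => h₁ _) (fun s _ => h₂ _)
    τ ⟨hτ, le_rfl⟩
  simpa only [linearFlow_zero_apply] using h

/-- **(T) for a bounded generator, in the shape consumed by `EmergenceMildDuhamel` /
`StabilityMildDuhamel`:** under the two-level certificate of `norm_linearFlow_le_of_two_level`,
`‖e^{τA} x‖ ≤ S · τ^{−1/2} · e^{ωτ} · p x` for all `τ > 0`, all `x`, with `S = √(M₁/(c m₂))` and the
weak norm `p x = √Re⟪D₁x, x⟫`. -/
theorem smoothing_bound_linearFlow (A : E →L[ℝ] E) {G₁ G₂ D₁ : E →L[ℝ] E}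
    (hG₁ : ∀ x y : E, ⟪G₁ x, y⟫_𝕜 = ⟪x, G₁ y⟫_𝕜) (hG₂ : ∀ x y : E, ⟪G₂ x, y⟫_𝕜 = ⟪x, G₂ y⟫_𝕜)
    (hG₁pos : ∀ x : E, 0 ≤ re ⟪G₁ x, x⟫_𝕜) {ω c m₂ M₁ : ℝ} (hc : 0 < c) (hm₂ : 0 < m₂)
    (hM₁ : 0 ≤ M₁) (hm₂' : ∀ x : E, m₂ * ‖x‖ ^ 2 ≤ re ⟪G₂ x, x⟫_𝕜)
    (hD₁ : ∀ x : E, 0 ≤ re ⟪D₁ x, x⟫_𝕜) (hM₁' : ∀ x : E, re ⟪G₁ x, x⟫_𝕜 ≤ M₁ * re ⟪D₁ x, x⟫_𝕜)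
    (h₁ : ∀ w : E, 2 * re ⟪G₁ w, A w⟫_𝕜 + c * re ⟪G₂ w, w⟫_𝕜 ≤ 2 * ω * re ⟪G₁ w, w⟫_𝕜)
    (h₂ : ∀ w : E, re ⟪G₂ w, A w⟫_𝕜 ≤ ω * re ⟪G₂ w, w⟫_𝕜) :
    ∀ τ : ℝ, 0 < τ → ∀ x : E, ‖exp (τ • A) x‖ ≤ Real.sqrt (M₁ / (c * m₂)) * τ ^ (-(1 / 2 : ℝ)) *
      Real.exp (ω * τ) * Real.sqrt (re ⟪D₁ x, x⟫_𝕜) :=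
  smoothing_bound_of_two_level_shape (T := fun τ x => exp (τ • A) x)
    (q := fun x => re ⟪D₁ x, x⟫_𝕜) hD₁
    (norm_linearFlow_le_of_two_level A hG₁ hG₂ hG₁pos hc hm₂ hM₁ hm₂' hD₁ hM₁' h₁ h₂)

/-! ### R-β and its KILL twin for a bounded generator, modulo (B) only -/

/-- **R-β FOR A BOUNDED GENERATOR (the amplitude floor and the clock), modulo (B) only.** Let
`A : E →L[ℝ] E` carry the two-level certificate of `norm_linearFlow_le_of_two_level` (constants
`ω, c, m₂, M₁`, reference weight `D₁`; put `S = √(M₁/(c m₂))`), a normalised real eigenpair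
`A v = λ v`, `‖v‖ = 1`, with the gap `2λ > ω`, and let the nonlinearity `B` satisfy the bilinear
loss (B) `√Re⟪D₁ B(x,y), B(x,y)⟫ ≤ c_alg ‖x‖ ‖y‖` (`c_alg ≥ 0`). Put `C = S·c_alg·√(π/(2λ − ω))`.
Then EVERY classical solution `u` of `u' = A u + B(u, u)` on `[0, T₀]` (continuous on the window,
`s ↦ B(u s, u s)` continuous, the equation at interior points) with `u 0 = ε v` (`ε > 0`), on a
window where `C (3/2)² ε e^{λt} < 1/2`, satisfies `‖u t‖ ≥ ε e^{λt}/2` at every `t ∈ [0, T₀]` with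
`ε e^{λt} ≤ χ⋆ = 2/(9C)`: the perturbation reaches `χ⋆/2` no later than the linear clock
`t⋆ = λ⁻¹ log(χ⋆/ε)` (`EmergenceMildDuhamel.prediction_le_iff_le_clock`). (M) and (T) are
DISCHARGED here; only (B) is a hypothesis. -/
theorem half_prediction_of_classical (A : E →L[ℝ] E) (B : E → E → E) {G₁ G₂ D₁ : E →L[ℝ] E}
    (hG₁ : ∀ x y : E, ⟪G₁ x, y⟫_𝕜 = ⟪x, G₁ y⟫_𝕜) (hG₂ : ∀ x y : E, ⟪G₂ x, y⟫_𝕜 = ⟪x, G₂ y⟫_𝕜)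
    (hG₁pos : ∀ x : E, 0 ≤ re ⟪G₁ x, x⟫_𝕜) {ω c m₂ M₁ : ℝ} (hc : 0 < c) (hm₂ : 0 < m₂)
    (hM₁ : 0 ≤ M₁) (hm₂' : ∀ x : E, m₂ * ‖x‖ ^ 2 ≤ re ⟪G₂ x, x⟫_𝕜)
    (hD₁ : ∀ x : E, 0 ≤ re ⟪D₁ x, x⟫_𝕜) (hM₁' : ∀ x : E, re ⟪G₁ x, x⟫_𝕜 ≤ M₁ * re ⟪D₁ x, x⟫_𝕜)
    (h₁ : ∀ w : E, 2 * re ⟪G₁ w, A w⟫_𝕜 + c * re ⟪G₂ w, w⟫_𝕜 ≤ 2 * ω * re ⟪G₁ w, w⟫_𝕜)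
    (h₂ : ∀ w : E, re ⟪G₂ w, A w⟫_𝕜 ≤ ω * re ⟪G₂ w, w⟫_𝕜)
    {v : E} {lam ε : ℝ} (hv : A v = lam • v) (hv1 : ‖v‖ = 1) (hgap : ω < 2 * lam) (hε : 0 < ε)
    {calg : ℝ} (hcalg : 0 ≤ calg)
    (hB : ∀ x y : E, Real.sqrt (re ⟪D₁ (B x y), B x y⟫_𝕜) ≤ calg * ‖x‖ * ‖y‖)
    {u : ℝ → E} {T₀ : ℝ} (hu : ContinuousOn u (Icc 0 T₀))
    (hBu : ContinuousOn (fun s => B (u s) (u s)) (Icc 0 T₀))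
    (hderiv : ∀ s ∈ Ioo 0 T₀, HasDerivAt u (A (u s) + B (u s) (u s)) s) (hu0 : u 0 = ε • v)
    (hsmall : ∀ t ∈ Icc 0 T₀, Real.sqrt (M₁ / (c * m₂)) * calg *
      Real.sqrt (Real.pi / (2 * lam - ω)) * (3 / 2 : ℝ) ^ 2 * (ε * Real.exp (lam * t)) < 3 / 2 - 1)
    {t : ℝ} (ht : t ∈ Icc 0 T₀)
    (hχ : ε * Real.exp (lam * t) ≤
      2 / (9 * (Real.sqrt (M₁ / (c * m₂)) * calg * Real.sqrt (Real.pi / (2 * lam - ω))))) :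
    ε * Real.exp (lam * t) / 2 ≤ ‖u t‖ := by
  have hS : 0 ≤ Real.sqrt (M₁ / (c * m₂)) := Real.sqrt_nonneg _
  have hT := smoothing_bound_linearFlow A hG₁ hG₂ hG₁pos hc hm₂ hM₁ hm₂' hD₁ hM₁' h₁ h₂
  have hmild := mild_formula_of_classical A (fun x => B x x) hu hBu hderiv
  have hℓ : ∀ t ∈ Icc 0 T₀, ‖exp (t • A) (u 0)‖ = ε * Real.exp (lam * t) := fun t ht => by
    rw [hu0]; exact norm_linearFlow_smul_eigenvector A hv hv1 hε.le ht.1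
  exact half_prediction_of_mild (p := fun x => Real.sqrt (re ⟪D₁ x, x⟫_𝕜))
    (T := fun τ x => exp (τ • A) x) (B := B) (u := u) (ℓ := fun t => exp (t • A) (u 0))
    hS hcalg hgap hε hT hB hu hmild hℓ hsmall ht hχ

/-- **THE KILL TWIN FOR A BOUNDED GENERATOR (basin radius and decay), modulo (B) only.** Let
`A : E →L[ℝ] E` carry the two-level certificate of `norm_linearFlow_le_of_two_level` with
`ω < 2λ ≤ 0` (`S = √(M₁/(c m₂))`), a strong 3-L certificate `m‖x‖² ≤ Re⟪Gx,x⟫ ≤ M‖x‖²`,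
`Re⟪G w, A w⟫ ≤ ω₁ Re⟪G w, w⟫` for all `w`, with abscissa `ω₁ ≤ λ`, and let `B` satisfy (B) with
constant `c_alg`. Put `C = S·c_alg·√(π/(2λ − ω))`. Then every classical solution `u` of
`u' = A u + B(u, u)` on `[0, T₀]` whose seed satisfies `√(M/m)·‖u 0‖ ≤ ε` with `ε > 0` below the
BASIN RADIUS, `4Cε < 1`, obeys `‖u t‖ ≤ 2ε e^{λt}` on the whole window. (M) and both levels of (T)
are DISCHARGED here; only (B) is a hypothesis. -/
theorem decay_two_of_classical (A : E →L[ℝ] E) (B : E → E → E) {G₁ G₂ D₁ : E →L[ℝ] E}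
    (hG₁ : ∀ x y : E, ⟪G₁ x, y⟫_𝕜 = ⟪x, G₁ y⟫_𝕜) (hG₂ : ∀ x y : E, ⟪G₂ x, y⟫_𝕜 = ⟪x, G₂ y⟫_𝕜)
    (hG₁pos : ∀ x : E, 0 ≤ re ⟪G₁ x, x⟫_𝕜) {ω c m₂ M₁ : ℝ} (hc : 0 < c) (hm₂ : 0 < m₂)
    (hM₁ : 0 ≤ M₁) (hm₂' : ∀ x : E, m₂ * ‖x‖ ^ 2 ≤ re ⟪G₂ x, x⟫_𝕜)
    (hD₁ : ∀ x : E, 0 ≤ re ⟪D₁ x, x⟫_𝕜) (hM₁' : ∀ x : E, re ⟪G₁ x, x⟫_𝕜 ≤ M₁ * re ⟪D₁ x, x⟫_𝕜)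
    (h₁ : ∀ w : E, 2 * re ⟪G₁ w, A w⟫_𝕜 + c * re ⟪G₂ w, w⟫_𝕜 ≤ 2 * ω * re ⟪G₁ w, w⟫_𝕜)
    (h₂ : ∀ w : E, re ⟪G₂ w, A w⟫_𝕜 ≤ ω * re ⟪G₂ w, w⟫_𝕜)
    {G : E →L[ℝ] E} (hG : ∀ x y : E, ⟪G x, y⟫_𝕜 = ⟪x, G y⟫_𝕜) {m M ω₁ : ℝ} (hm0 : 0 < m)
    (hm : ∀ x : E, m * ‖x‖ ^ 2 ≤ re ⟪G x, x⟫_𝕜) (hM : ∀ x : E, re ⟪G x, x⟫_𝕜 ≤ M * ‖x‖ ^ 2)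
    (hL : ∀ w : E, re ⟪G w, A w⟫_𝕜 ≤ ω₁ * re ⟪G w, w⟫_𝕜)
    {lam : ℝ} (hgap : ω < 2 * lam) (hlam : lam ≤ 0) (hrate : ω₁ ≤ lam)
    {calg : ℝ} (hcalg : 0 ≤ calg)
    (hB : ∀ x y : E, Real.sqrt (re ⟪D₁ (B x y), B x y⟫_𝕜) ≤ calg * ‖x‖ * ‖y‖)
    {u : ℝ → E} {T₀ : ℝ} (hu : ContinuousOn u (Icc 0 T₀))
    (hBu : ContinuousOn (fun s => B (u s) (u s)) (Icc 0 T₀))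
    (hderiv : ∀ s ∈ Ioo 0 T₀, HasDerivAt u (A (u s) + B (u s) (u s)) s)
    {ε : ℝ} (hε : 0 < ε) (hseed : Real.sqrt (M / m) * ‖u 0‖ ≤ ε)
    (hbasin : 4 * (Real.sqrt (M₁ / (c * m₂)) * calg * Real.sqrt (Real.pi / (2 * lam - ω))) * ε < 1) :
    ∀ t ∈ Icc 0 T₀, ‖u t‖ ≤ 2 * (ε * Real.exp (lam * t)) := by
  have hS : 0 ≤ Real.sqrt (M₁ / (c * m₂)) := Real.sqrt_nonneg _
  have hT := smoothing_bound_linearFlow A hG₁ hG₂ hG₁pos hc hm₂ hM₁ hm₂' hD₁ hM₁' h₁ h₂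
  have hmild := mild_formula_of_classical A (fun x => B x x) hu hBu hderiv
  have hℓ : ∀ t ∈ Icc 0 T₀, ‖exp (t • A) (u 0)‖ ≤ ε * Real.exp (lam * t) := by
    intro t ht
    have h1 := norm_linearFlow_le_of_generator_form A hG hm0 hm hM hL t ht.1 (u 0)
    have h2 : Real.exp (ω₁ * t) ≤ Real.exp (lam * t) :=
      Real.exp_le_exp.mpr (mul_le_mul_of_nonneg_right hrate ht.1)
    calc ‖exp (t • A) (u 0)‖ ≤ Real.sqrt (M / m) * Real.exp (ω₁ * t) * ‖u 0‖ := h1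
      _ = (Real.sqrt (M / m) * ‖u 0‖) * Real.exp (ω₁ * t) := by ring
      _ ≤ ε * Real.exp (lam * t) := mul_le_mul hseed h2 (Real.exp_pos _).le hε.le
  exact decay_two_of_mild (p := fun x => Real.sqrt (re ⟪D₁ x, x⟫_𝕜))
    (T := fun τ x => exp (τ • A) x) (B := B) (u := u) (ℓ := fun t => exp (t • A) (u 0))
    hS hcalg hgap hlam hε hT hB hu hmild hℓ hbasin

end Summit.NavierStokesRegularity.FluidComputer.BoundedGeneratorEmergence

end
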